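import Literature.NumberTheory.EllipticCurves.HeegnerPointsGaloisDescent
import Mathlib.FieldTheory.KummerPolynomial
import HarnessLib

set_option linter.dupNamespace false
set_option autoImplicit false

/-!
# Genus points descend to the field cut out by their character: the `χ`-twisted trace of a point
# over a Galois extension `L/k` is rational over `k(√d)` when `χ` is the quadratic character of `√d`
# (Gross 1984 §4; Coates–Li–Tian–Zhai 2015 Thm. 2.5 / (2.8): "`K(√R)` is a subfield of `H_R` …
# `y_R = Σ_{σ ∈ Gal(H_R/K)} χ_R(σ) f(P_R)^σ`")

Cell `bsd-goldfeld`, seat `bsd-goldfeld-s1p-c3` (prover, gen 6); TARGET v5.2 §2 c3 (e) GENUS ASSEMBLY, step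
G5b-(R) (rationality of the genus point over the genus field). Support for item `stmt-BirchSwinnertonDyer-19140`
(crux twin″ `Theses.GoldfeldAllTwistsTwoConverse.BSDTwoCMSevenAdditiveRankOne`) of
`route-BirchSwinnertonDyer-GoldfeldAllTwistsTwoConverse`; clean cone (no Theses import). Builds on the tree's
`HeegnerPointsGaloisDescent.lean` (descent of the full trace to the base field:
`exists_map_eq_of_forall_map_galois_eq`, `exists_map_eq_sum_of_galois_perm`). Everything is PROVED
(theorems only; no definition, no named fact); pure Galois bookkeeping for a
Weierstrass model `W/ℚ`, fields `k ⊆ L` of characteristic `0` with `L/k` finite Galois, a point `y ∈ W(L)`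
and an element `r₀ ∈ L` with `r₀² = d ∈ k`:

* `map_sum_smul_map_eq_of_invariant` — for `τ ∈ Gal(L/k)` and integer weights `ε` with
  `ε(τσ) = ε(σ)`: `τ(Σ_σ ε(σ)•σy) = Σ_σ ε(σ)•σy`.
* `apply_sqrt_eq_self_or_neg` — `σ r₀ = ±r₀`; `cutout_mul_eq_of_apply_eq` — the quadratic ("cutout")
  weight `ε(σ) = [σ r₀ = r₀ ? 1 : −1]` and the genus indicator weights are invariant under left
  multiplication by any `τ` fixing `r₀`.
* `exists_map_adjoin_eq_of_forall_fixing` — a point of `W(L)` fixed by every `σ ∈ Gal(L/k)` with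
  `σ r₀ = r₀` comes from `W(k(r₀))` (the tree's Galois descent over the intermediate field `k⟮r₀⟯`,
  `L/k⟮r₀⟯` being Galois).
* **`exists_map_adjoin_eq_twistedSum`** / **`exists_map_adjoin_eq_genusHalfSum`** — the `χ`-twisted trace
  `y_χ = Σ_σ ε(σ)•σy` and the half-trace over one genus `Σ_{σ r₀ ≠ r₀} σy` are rational over `k(r₀)`;
  `sum_map_sub_twistedSum_eq_two_smul` — the genus identity `Σ_σ σy − y_χ = 2•Σ_{σ r₀ ≠ r₀} σy`;
  `finrank_adjoin_sqrt_eq_two` — `[k(r₀) : k] = 2` when `d` is not a square in `k`.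

HONEST FRAMING (cell `bsd-goldfeld`, seat s1p-c3 gen 6): the (R)-core of the rationality half of the
genus-point input `X049GenusPointOddMultiple` of LINE B49 — applied later with `L = K[1]` (Hilbert class
field ⊂ ℂ), `k = K = ℚ(√−q)`, `r₀ = √q ∈ K[1]` (`sqrt_mem_ringClassField_one_of_discr_eq`), `y` the
conductor-one Heegner point; nothing about `L`-functions or BSD is asserted.

References: B. Gross, *Heegner points on X₀(N)* (1984) §4 [Gross1984]; J. Coates, Y. Li, Y. Tian, S. Zhai,
PLMS 110 (2015) Thm. 2.5, (2.8) [CoatesLiTianZhai2015]; J. H. Silverman, *AEC* (2009) I.§1, VIII.§1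
[SilvermanAEC2009].
-/

noncomputable section

open scoped Classical IntermediateField
open Polynomial

universe v w

namespace Summit.BirchSwinnertonDyer.BirchSwinnertonDyer.Theorems.GoldfeldGoodTwists

open Literature.NumberTheory.EllipticCurves

variable {k : Type v} {L : Type w} [Field k] [CharZero k] [Field L] [CharZero L] [Algebra k L]
  (W : WeierstrassCurve ℚ)

/-! ### Invariance of weighted sums of conjugates -/

/-- **`τ(Σ_σ ε(σ)•σy) = Σ_σ ε(σ)•σy` when the weights are `τ`-invariant** (`ε(τσ) = ε(σ)`): reindex the
sum by `σ ↦ τσ`. [folklore] -/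
theorem map_sum_smul_map_eq_of_invariant [FiniteDimensional k L] (τ : L ≃ₐ[k] L)
    (ε : (L ≃ₐ[k] L) → ℤ) (hε : ∀ σ, ε (τ * σ) = ε σ) (y : (W.baseChange L).toAffine.Point) :
    WeierstrassCurve.Affine.Point.map (τ : L →ₐ[k] L)
        (∑ σ : L ≃ₐ[k] L, ε σ • WeierstrassCurve.Affine.Point.map (σ : L →ₐ[k] L) y) =
      ∑ σ : L ≃ₐ[k] L, ε σ • WeierstrassCurve.Affine.Point.map (σ : L →ₐ[k] L) y := by
  rw [map_sum]
  simp_rw [map_zsmul, WeierstrassCurve.Affine.Point.map_map]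
  -- `∑_σ ε σ • (τσ) y = ∑_σ ε (τσ) • (τσ) y = ∑_σ' ε σ' • σ' y`
  have h : ∀ σ : L ≃ₐ[k] L, ((τ : L →ₐ[k] L).comp (σ : L →ₐ[k] L)) = ((τ * σ : L ≃ₐ[k] L) : L →ₐ[k] L) :=
    fun σ => rfl
  simp_rw [h]
  calc ∑ σ : L ≃ₐ[k] L, ε σ • WeierstrassCurve.Affine.Point.map ((τ * σ : L ≃ₐ[k] L) : L →ₐ[k] L) y
      = ∑ σ : L ≃ₐ[k] L, ε (τ * σ) • WeierstrassCurve.Affine.Point.map ((τ * σ : L ≃ₐ[k] L) : L →ₐ[k] L) y := by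
        simp_rw [hε]
    _ = ∑ σ : L ≃ₐ[k] L, ε σ • WeierstrassCurve.Affine.Point.map (σ : L →ₐ[k] L) y :=
        Fintype.sum_equiv (Equiv.mulLeft τ) _ _ fun _ => rfl

/-! ### The quadratic character of `√d` -/

omit [CharZero k] [CharZero L] in
/-- A `k`-automorphism maps a square root `r₀` of `d ∈ k` to `±r₀`. [folklore] -/
theorem apply_sqrt_eq_self_or_neg (σ : L ≃ₐ[k] L) {r₀ : L} {d : k} (hr : r₀ ^ 2 = algebraMap k L d) :
    σ r₀ = r₀ ∨ σ r₀ = -r₀ := by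
  have h : (σ r₀) ^ 2 = r₀ ^ 2 := by rw [← map_pow, hr, AlgEquiv.commutes]
  exact sq_eq_sq_iff_eq_or_eq_neg.mp h

omit [CharZero k] [CharZero L] in
/-- If `τ` fixes `r₀` then `(τσ) r₀ = r₀ ↔ σ r₀ = r₀` (`σ r₀ = ±r₀` and `τ(−r₀) = −r₀`). [folklore] -/
theorem mul_apply_sqrt_eq_iff (τ σ : L ≃ₐ[k] L) {r₀ : L} {d : k} (hr : r₀ ^ 2 = algebraMap k L d)
    (hτ : τ r₀ = r₀) : (τ * σ) r₀ = r₀ ↔ σ r₀ = r₀ := by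
  rw [AlgEquiv.mul_apply]
  rcases apply_sqrt_eq_self_or_neg σ hr with h | h
  · rw [h, hτ]
  · rw [h, map_neg, hτ]

omit [CharZero k] [CharZero L] in
/-- **The cutout weight `ε(σ) = 1` if `σ r₀ = r₀`, `−1` otherwise, is invariant under left multiplication
by any `τ` fixing `r₀`** (it is the quadratic character of `k(r₀)/k` read on `Gal(L/k)`). [folklore] -/
theorem cutout_mul_eq_of_apply_eq (τ σ : L ≃ₐ[k] L) {r₀ : L} {d : k} (hr : r₀ ^ 2 = algebraMap k L d)
    (hτ : τ r₀ = r₀) :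
    (if (τ * σ) r₀ = r₀ then (1 : ℤ) else -1) = (if σ r₀ = r₀ then (1 : ℤ) else -1) := by
  rw [mul_apply_sqrt_eq_iff τ σ hr hτ]

omit [CharZero k] [CharZero L] in
/-- The genus indicator weight `[σ r₀ ≠ r₀]` (resp. `[σ r₀ = r₀]`) is likewise invariant. [folklore] -/
theorem indicator_mul_eq_of_apply_eq (τ σ : L ≃ₐ[k] L) {r₀ : L} {d : k} (hr : r₀ ^ 2 = algebraMap k L d)
    (hτ : τ r₀ = r₀) (a b : ℤ) :
    (if (τ * σ) r₀ = r₀ then a else b) = (if σ r₀ = r₀ then a else b) := by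
  rw [mul_apply_sqrt_eq_iff τ σ hr hτ]

/-! ### Descent to `k(r₀)` -/

/-- **A point fixed by `Gal(L/k(r₀))` comes from `W(k(r₀))`**: if `P ∈ W(L)` is fixed by every
`σ ∈ Gal(L/k)` with `σ r₀ = r₀`, then `P` is the image of a point of `W(k⟮r₀⟯)` (the tree's Galois
descent `exists_map_eq_of_forall_map_galois_eq` over the intermediate field `k⟮r₀⟯`, over which `L` is
Galois; an automorphism over `k⟮r₀⟯` restricts to one over `k` fixing `r₀`).
[cite: SilvermanAEC2009, I.§1 and VIII.§1] -/
theorem exists_map_adjoin_eq_of_forall_fixing [FiniteDimensional k L] [IsGalois k L] (r₀ : L)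
    {P : (W.baseChange L).toAffine.Point}
    (hP : ∀ σ : L ≃ₐ[k] L, σ r₀ = r₀ → WeierstrassCurve.Affine.Point.map (σ : L →ₐ[k] L) P = P) :
    ∃ P₀ : (W.baseChange k⟮r₀⟯).toAffine.Point,
      WeierstrassCurve.Affine.Point.map (algebraMap k⟮r₀⟯ L).toRatAlgHom P₀ = P := by
  refine exists_map_eq_of_forall_map_galois_eq W (k := k⟮r₀⟯) fun τ => ?_
  have hτ : (τ.restrictScalars k) r₀ = r₀ := by
    rw [AlgEquiv.restrictScalars_apply]
    have := τ.commutes ⟨r₀, IntermediateField.mem_adjoin_simple_self k r₀⟩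
    simpa using this
  have h := hP (τ.restrictScalars k) hτ
  rcases P with _ | ⟨x, y, hxy⟩
  · rfl
  · rw [WeierstrassCurve.Affine.Point.map_some] at h ⊢
    simpa only [WeierstrassCurve.Affine.Point.some.injEq, AlgEquiv.coe_toAlgHom,
      AlgEquiv.restrictScalars_apply] using h

/-- **The `χ`-twisted trace is rational over `k(r₀)`.** For `y ∈ W(L)` and `r₀ ∈ L` with `r₀² = d ∈ k`,
the point `y_χ = Σ_{σ ∈ Gal(L/k)} ε(σ)•σy`, `ε(σ) = ±1` according as `σ r₀ = ±r₀`, is the image of a point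
of `W(k⟮r₀⟯)` (Coates–Li–Tian–Zhai 2015 (2.8): `y_R ∈ E(K(√R))`-type rationality of genus points).
[cite: CoatesLiTianZhai2015, Thm. 2.5 and (2.8)] [cite: Gross1984, §4] -/
theorem exists_map_adjoin_eq_twistedSum [FiniteDimensional k L] [IsGalois k L] {r₀ : L} {d : k}
    (hr : r₀ ^ 2 = algebraMap k L d) (y : (W.baseChange L).toAffine.Point) :
    ∃ P₀ : (W.baseChange k⟮r₀⟯).toAffine.Point,
      WeierstrassCurve.Affine.Point.map (algebraMap k⟮r₀⟯ L).toRatAlgHom P₀ =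
        ∑ σ : L ≃ₐ[k] L, (if σ r₀ = r₀ then (1 : ℤ) else -1) •
          WeierstrassCurve.Affine.Point.map (σ : L →ₐ[k] L) y :=
  exists_map_adjoin_eq_of_forall_fixing W r₀ fun τ hτ =>
    map_sum_smul_map_eq_of_invariant W τ _ (fun σ => cutout_mul_eq_of_apply_eq τ σ hr hτ) y

/-- **The half-trace over one genus is rational over `k(r₀)`**: `Σ_{σ : σ r₀ ≠ r₀} σy` (written as the
weighted sum with weights `0/1`) is the image of a point of `W(k⟮r₀⟯)`; likewise for `σ r₀ = r₀`.
[cite: CoatesLiTianZhai2015, Thm. 2.5 and (2.8)] [cite: Gross1984, §4] -/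
theorem exists_map_adjoin_eq_genusHalfSum [FiniteDimensional k L] [IsGalois k L] {r₀ : L} {d : k}
    (hr : r₀ ^ 2 = algebraMap k L d) (y : (W.baseChange L).toAffine.Point) (a b : ℤ) :
    ∃ P₀ : (W.baseChange k⟮r₀⟯).toAffine.Point,
      WeierstrassCurve.Affine.Point.map (algebraMap k⟮r₀⟯ L).toRatAlgHom P₀ =
        ∑ σ : L ≃ₐ[k] L, (if σ r₀ = r₀ then a else b) •
          WeierstrassCurve.Affine.Point.map (σ : L →ₐ[k] L) y :=
  exists_map_adjoin_eq_of_forall_fixing W r₀ fun τ hτ =>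
    map_sum_smul_map_eq_of_invariant W τ _ (fun σ => indicator_mul_eq_of_apply_eq τ σ hr hτ a b) y

/-- **The genus identity** `Σ_σ σy − Σ_σ ε(σ)•σy = 2 • Σ_{σ r₀ ≠ r₀} σy` (termwise `1 − ε(σ) ∈ {0, 2}`;
Tian 2014 (1.3) at `k = 1`). [cite: CoatesLiTianZhai2015, (2.8)] -/
theorem sum_map_sub_twistedSum_eq_two_smul [FiniteDimensional k L] (r₀ : L)
    (y : (W.baseChange L).toAffine.Point) :
    ∑ σ : L ≃ₐ[k] L, WeierstrassCurve.Affine.Point.map (σ : L →ₐ[k] L) y -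
        ∑ σ : L ≃ₐ[k] L, (if σ r₀ = r₀ then (1 : ℤ) else -1) •
          WeierstrassCurve.Affine.Point.map (σ : L →ₐ[k] L) y =
      (2 : ℤ) • ∑ σ : L ≃ₐ[k] L, (if σ r₀ = r₀ then (0 : ℤ) else 1) •
          WeierstrassCurve.Affine.Point.map (σ : L →ₐ[k] L) y := by
  rw [← Finset.sum_sub_distrib, Finset.smul_sum]
  refine Finset.sum_congr rfl fun σ _ => ?_
  by_cases h : σ r₀ = r₀
  · simp [h]
  · rw [if_neg h, if_neg h, neg_one_zsmul, sub_neg_eq_add, one_zsmul, two_zsmul]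

/-! ### `[k(r₀) : k] = 2` -/

omit [CharZero k] [CharZero L] in
/-- `[k⟮r₀⟯ : k] = 2` for `r₀² = d` with `d` not a square in `k` (`X² − d` irreducible, Mathlib
`X_pow_sub_C_irreducible_of_prime`). [folklore] -/
theorem finrank_adjoin_sqrt_eq_two [FiniteDimensional k L] {r₀ : L} {d : k}
    (hr : r₀ ^ 2 = algebraMap k L d) (hd : ¬ IsSquare d) : Module.finrank k k⟮r₀⟯ = 2 := by
  have hirr : Irreducible (X ^ 2 - C d : k[X]) := by
    refine X_pow_sub_C_irreducible_of_prime Nat.prime_two fun b hb => hd ⟨b, ?_⟩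
    rw [← hb]; ring
  have hint : IsIntegral k r₀ := Algebra.IsIntegral.isIntegral r₀
  have hmin : minpoly k r₀ = X ^ 2 - C d := by
    refine (minpoly.eq_of_irreducible_of_monic hirr ?_ (monic_X_pow_sub_C d two_ne_zero)).symm
    simp [hr]
  rw [IntermediateField.adjoin.finrank hint, hmin, natDegree_X_pow_sub_C]

omit [CharZero k] [CharZero L] in
/-- `r₀ ∉ k` when `d = r₀²` is not a square in `k`. [folklore] -/
theorem algebraMap_ne_sqrt_of_not_isSquare {r₀ : L} {d : k} (hr : r₀ ^ 2 = algebraMap k L d)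
    (hd : ¬ IsSquare d) (a : k) : algebraMap k L a ≠ r₀ := by
  intro ha
  apply hd
  refine ⟨a, ?_⟩
  have h2 : algebraMap k L (a ^ 2) = algebraMap k L d := by rw [map_pow, ha, hr]
  rw [← (algebraMap k L).injective h2]; ring

end Summit.BirchSwinnertonDyer.BirchSwinnertonDyer.Theorems.GoldfeldGoodTwists

end
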